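import Summits.Ventures.PercRepro.S1CoreCapSixThree

/-!
# PercRepro — TOWARDS `Q*(7) = 19`: FOUR BIG LINES ARE IMPOSSIBLE AT NULLITY `7` (p1, gen 26)

The first case of the instance `ν = 7` of the 4-circuit-cap spec, and THE FIRST USE OF A PLANE CLAUSE in the
lane: at `ν ≤ 6` the cost clause alone settled every case (`fourCapSpec_three` … `fourCapSpec_six` never read
`h5` / `h6`); at `ν = 7` the cost clause allows four simple 4-point lines in general position (every line meets
the other three in three distinct points, ten points, cost `2 + 2 + 2 + 1 = 7`), and it is the clause
`lineRank l ≤ 3 → |unionL l| ≤ 9` that kills them (the ordering has `lineRank = 2 + 1 + 0 + 0 = 3` on ten points).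
Without the plane clauses the searches' value at `ν = 7` would be `22` (four 4-lines in general position plus
six transversal 3-lines), with them it is `19`.

`not_four_big`: four distinct lines of `≥ 4` points contradict the clauses at nullity `7`. The cost of the
ordering `L₁, L₂, L₃, L₄` is `(|L₁| − 2 + fat) + (|L₂| − 2 + fat) + (|L₃| − 2 + fat) + (|L₄| − max old₄ 2 + fat)
≤ 7`, so every line is a simple 4-point line and the last one meets the union of the other three in three points;
applied to the four orderings with each line last, every line meets each other line, and the list
`[L₄, L₃, L₂, L₁]` has `lineRank = 3` and union of `4 + 3 + 2 + 1 = 10` points. `proofs/P1-S4-CAPBRIDGE.md` §18.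
Axioms: standard.
-/

namespace PercRepro

namespace S1

namespace FourCap

namespace Seven

variable {β : Type} [DecidableEq β]

section FourBig

variable {w : β → ℕ} {ls : Finset (Finset β)}
  (h1 : ∀ L ∈ ls, ∀ v ∈ L, w v = 1 ∨ w v = 2)
  (h2 : ∀ L ∈ ls, 3 ≤ L.card ∧ wsum w L ≤ 5)
  (h3 : ∀ L ∈ ls, ∀ L' ∈ ls, L ≠ L' → (L ∩ L').card ≤ 1)
  (h4 : ∀ l : List (Finset β), l.Nodup → (∀ L ∈ l, L ∈ ls) → wsum w (unionL l) ≤ 7 + lineRank l)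
  (h5 : ∀ l : List (Finset β), l.Nodup → (∀ L ∈ l, L ∈ ls) → lineRank l ≤ 3 → (unionL l).card ≤ 9)

include h1 h2 h3 h4 in
/-- **The last of four big lines meets the union of the other three in three points, and all four are simple
4-point lines**: the ordering `L₁, L₂, L₃, L₄` costs `(|L₁| − 2 + fat L₁) + (|L₂| − 2 + fat) + (|L₃| − 2 + fat)
+ (|L₄| − max old₄ 2 + fat) ≤ 7` with `old₄ ≤ 3`. -/
theorem last_of_four_big {L₁ L₂ L₃ L₄ : Finset β} (hL₁ : L₁ ∈ ls) (hL₂ : L₂ ∈ ls) (hL₃ : L₃ ∈ ls) (hL₄ : L₄ ∈ ls)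
    (h12 : L₂ ≠ L₁) (h13 : L₃ ≠ L₁) (h14 : L₄ ≠ L₁) (h23 : L₃ ≠ L₂) (h24 : L₄ ≠ L₂) (h34 : L₄ ≠ L₃)
    (c1 : 4 ≤ L₁.card) (c2 : 4 ≤ L₂.card) (c3 : 4 ≤ L₃.card) (c4 : 4 ≤ L₄.card) :
    L₁.card = 4 ∧ L₂.card = 4 ∧ L₃.card = 4 ∧ L₄.card = 4 ∧ fat w L₁ = 0 ∧
      (L₄ ∩ (L₃ ∪ (L₂ ∪ L₁))).card = 3 := by
  have hc := costSum_le h1 (two_le_card_of_spec h2) h4 [L₄, L₃, L₂, L₁]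
    (by simp [h12, h13, h14, h23, h24, h34]) (by simp [hL₁, hL₂, hL₃, hL₄])
  simp only [costSum, unionL, Finset.union_empty, Nat.zero_add] at hc
  have e1 := lineCost_empty w L₁
  have e2 := lineCost_of_inter_le_two (w := w) (le_trans (h3 L₂ hL₂ L₁ hL₁ h12) (by omega))
  have e3 := lineCost_of_inter_le_two (w := w) (le_trans (card_inter_union_le L₃ L₂ L₁)
    (by have := h3 L₃ hL₃ L₂ hL₂ h23; have := h3 L₃ hL₃ L₁ hL₁ h13; omega))
  have e4 := lineCost_ge (w := w) L₄ (L₃ ∪ (L₂ ∪ L₁))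
  have i4 : (L₄ ∩ (L₃ ∪ (L₂ ∪ L₁))).card ≤ 3 := le_trans (card_inter_union_le L₄ L₃ (L₂ ∪ L₁))
    (le_trans (Nat.add_le_add_left (card_inter_union_le L₄ L₂ L₁) _)
      (by have := h3 L₄ hL₄ L₃ hL₃ h34; have := h3 L₄ hL₄ L₂ hL₂ h24; have := h3 L₄ hL₄ L₁ hL₁ h14; omega))
  omega

include h1 h2 h3 h4 h5 in
/-- **Four big lines are impossible at nullity `7`**: by `last_of_four_big` in the four orderings with each
line last, the four lines are simple 4-point lines each meeting the union of the other three in three points, so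
`[L₄, L₃, L₂, L₁]` has `lineRank = 2 + 1 + 0 + 0 = 3` and a union of `4 + 3 + 2 + 1 = 10` points — against the
plane clause `lineRank ≤ 3 → ≤ 9` points. -/
theorem not_four_big {L₁ L₂ L₃ L₄ : Finset β} (hL₁ : L₁ ∈ ls) (hL₂ : L₂ ∈ ls) (hL₃ : L₃ ∈ ls) (hL₄ : L₄ ∈ ls)
    (h12 : L₂ ≠ L₁) (h13 : L₃ ≠ L₁) (h14 : L₄ ≠ L₁) (h23 : L₃ ≠ L₂) (h24 : L₄ ≠ L₂) (h34 : L₄ ≠ L₃)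
    (c1 : 4 ≤ L₁.card) (c2 : 4 ≤ L₂.card) (c3 : 4 ≤ L₃.card) (c4 : 4 ≤ L₄.card) : False := by
  -- each line last
  obtain ⟨k1, k2, k3, k4, -, i4⟩ := last_of_four_big h1 h2 h3 h4 hL₁ hL₂ hL₃ hL₄ h12 h13 h14 h23 h24 h34 c1 c2 c3 c4
  obtain ⟨-, -, -, -, -, i3⟩ := last_of_four_big h1 h2 h3 h4 hL₁ hL₂ hL₄ hL₃ h12 h14 h13 h24 h23 h34.symm
    c1 c2 c4 c3
  obtain ⟨-, -, -, -, -, i2⟩ := last_of_four_big h1 h2 h3 h4 hL₁ hL₃ hL₄ hL₂ h13 h14 h12 h34 h23.symm h24.symm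
    c1 c3 c4 c2
  -- pairwise intersections
  have p21 := h3 L₂ hL₂ L₁ hL₁ h12
  have p31 := h3 L₃ hL₃ L₁ hL₁ h13
  have p32 := h3 L₃ hL₃ L₂ hL₂ h23
  have p34 := h3 L₃ hL₃ L₄ hL₄ h34.symm
  have p24 := h3 L₂ hL₂ L₄ hL₄ h24.symm
  -- `L₂` meets `L₁`: from `L₂` last, `3 ≤ |L₂ ∩ L₄| + |L₂ ∩ L₃| + |L₂ ∩ L₁|`
  have j2 : (L₂ ∩ (L₄ ∪ (L₃ ∪ L₁))).card ≤ (L₂ ∩ L₄).card + ((L₂ ∩ L₃).card + (L₂ ∩ L₁).card) :=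
    le_trans (card_inter_union_le L₂ L₄ (L₃ ∪ L₁)) (Nat.add_le_add_left (card_inter_union_le L₂ L₃ L₁) _)
  have p23 := h3 L₂ hL₂ L₃ hL₃ h23.symm
  have e21 : (L₂ ∩ L₁).card = 1 := by omega
  -- `L₃` meets `L₂ ∪ L₁` in two points: from `L₃` last, `3 ≤ |L₃ ∩ L₄| + |L₃ ∩ (L₂ ∪ L₁)|`
  have j3 : (L₃ ∩ (L₄ ∪ (L₂ ∪ L₁))).card ≤ (L₃ ∩ L₄).card + (L₃ ∩ (L₂ ∪ L₁)).card :=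
    card_inter_union_le L₃ L₄ (L₂ ∪ L₁)
  have j3' : (L₃ ∩ (L₂ ∪ L₁)).card ≤ (L₃ ∩ L₂).card + (L₃ ∩ L₁).card := card_inter_union_le L₃ L₂ L₁
  have e3 : (L₃ ∩ (L₂ ∪ L₁)).card = 2 := by omega
  -- the list `[L₄, L₃, L₂, L₁]`: rank `3`, ten points
  have s2 := Finset.card_sdiff_add_card_inter L₂ L₁
  have s3 := Finset.card_sdiff_add_card_inter L₃ (L₂ ∪ L₁)
  have s4 := Finset.card_sdiff_add_card_inter L₄ (L₃ ∪ (L₂ ∪ L₁))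
  have u2 := Finset.card_union_add_card_inter L₂ L₁
  have u3 := Finset.card_union_add_card_inter L₃ (L₂ ∪ L₁)
  have u4 := Finset.card_union_add_card_inter L₄ (L₃ ∪ (L₂ ∪ L₁))
  have hr := h5 [L₄, L₃, L₂, L₁] (by simp [h12, h13, h14, h23, h24, h34]) (by simp [hL₁, hL₂, hL₃, hL₄])
  simp only [lineRank, unionL, Finset.union_empty, Finset.sdiff_empty, Finset.inter_empty, Finset.card_empty,
    Nat.zero_add] at hr
  omega

end FourBig

end Seven

end FourCap

end S1

end PercRepro
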